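import Literature.MathematicalPhysics.StatisticalMechanics.ComplexSpinFluctuationBound
import Literature.MathematicalPhysics.StatisticalMechanics.ComplexSpinCorrelationBound
import HarnessLib

/-!
# The two-point function of a complex spin system, mode by mode: the two Dirac modes and a
# square-summable remainder (Salmhofer–Seiler, CMP 139 (1991), Thm. 3.23 (1), (3.104)–(3.119))

Finite-volume half of the lattice form of Salmhofer–Seiler's **Theorem 3.23 (1)** (the structure
`T̂ = c₀δ₀ - c_π̂δ_π̂ + ĝ` of any thermodynamic limit of the two-point function, p. 415) and of the
infinite-volume statements **Thm. 4.8 (4.42) / Remark 4.10 (1) (4.43)** that rest on it; the passage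
to the limit is the companion file `ComplexSpinTwoPointMeasure`.  Everything is proved; no named fact.

For the complex spin system on the even torus `Λ = (ℤ/Lℤ)^ν` (`ComplexSpinInfraredBound`,
`ComplexSpinChiralLRO`) write `T_Λ(x) = ⟨σ₀σ_x⟩_Λ` (`corrFn`), `a_Λ = |Λ|⁻¹ T̂_Λ(0) = |Λ|⁻¹∑_x T_Λ(x)`
(`zeroMode`) and `b_Λ = |Λ|⁻¹ T̂_Λ(π̂) = |Λ|⁻¹∑_x ε(x)T_Λ(x)` (`stagMode`) — the weights of the two
Dirac masses of `T̂_Λ = |Λ|⁻¹ ∑_k T̂_Λ(k) δ_k` (3.115) at `k = 0` and `k = π̂`.  This file proves: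

* **(3.104) with the atoms separated** (`corrFn_decomp`):
  `T_Λ(x) = a_Λ + b_Λ ε(x) + |Λ|⁻¹ ∑_{k ∉ {0,π̂}} T̂_Λ(k) e^{-ikx}`;
* **(3.113)** (`abs_twoPtHat_div_le`): `|T̂_Λ(k)| ≤ b(k)/2N`, `b = max(D⁻¹, D̄⁻¹)` (3.114), from the
  tree's mode-wise infrared bounds (3.112) (`twoPtHat_mode_le`, `neg_twoPtHat_mode_le`);
* a **continuous momentum cutoff** `φ_η = min(1, D/η, D̄/η)` (`cutoff`) splitting the remainder into
  a FAR part `F_Λ(x) = |Λ|⁻¹∑_k φ_η T̂_Λ(k) e^{-ikx}` with **`∑_{x∈Λ} |F_Λ(x)|² ≤ (2Nη)⁻²` uniformly in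
  `Λ`** (Parseval, `sum_norm_sq_farPart_le`) and a NEAR part bounded in sup norm by
  `n_Λ(η) = N⁻¹|Λ|⁻¹∑_k (D(k)⁻¹ - η⁻¹)⁺` (`norm_remainder_sub_farPart_le`; the antiferromagnetic modes
  are folded onto the ferromagnetic ones by `k ↦ k + π̂`, (4.14)); together
  (`sum_sq_posPart_remainder_le`): `∑_{x∈S} ((|T_Λ(x) - a_Λ - b_Λε(x)| - n_Λ(η))⁺)² ≤ (2Nη)⁻²` for every
  set of sites `S` — the lattice content of "`ĝ` is absolutely continuous";
* **the signs of the atoms** (the "peaking argument" of the printed proof): `a_Λ ≥ -(4νN|Λ|)⁻¹`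
  (`neg_le_zeroMode`, (3.112) at `k = 0`) and `b_Λ ≤ (4νN|Λ|)⁻¹` (`stagMode_le`, (3.112) at `k = π̂`),
  so `c₀ ≥ 0`, `c_π̂ ≥ 0` in the limit; `|a_Λ|, |b_Λ| ≤ 1` under `|T_Λ| ≤ 1` ((3.117));
* **`m = 0`**: `T_Λ = 0` on the even sublattice ((3.101)) and `b_Λ = -a_Λ` ((3.106): `c₀ = c_π̂`);
* **the near bound as a momentum sum and its limit** ((3.118)–(3.119)):
  `n_Λ(η) = N⁻¹(R_Λ(ν) - L^{-ν}∑_k g_η(D(p_k)) + L^{-ν}η⁻¹)` with `g_η = 1/max(·, η)` (`nearBound_eq`),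
  `n_Λ(η) → n(η) = N⁻¹(R(ν) - (2π)^{-ν}∫ g_η∘D)` along even `L → ∞` for `ν ≥ 3`
  (`nearBound_tendsto`, by `torusGreen_tendsto_latticeGreen` and Riemann sums of the continuous
  `g_η∘D`), `n(η) ≤ N⁻¹(2π)^{-ν}∫(D⁻¹ - η⁻¹)⁺ → 0` as `η → 0` (`nearLimit_le`, `exists_nearLimit_le`:
  dominated convergence, "because `b` is integrable" for `ν ≥ 3`);
* the staggered sign `ε` on `ℤ^ν` (`latSgn`) and its reading on even tori (`sgn_proj`).

HOW IT DIFFERS FROM THE PRINT.  The printed proof views `T̂_Λ` as a distribution, bounds its total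
variation uniformly ((3.115)–(3.119)) and invokes the Riesz–Markov theorem; the absolute continuity
of `ĝ` and the signs of `c₀, c_π̂` come from the two-sided density bound (3.113) and a peaking
argument "as in [18]".  Here no measure on `[-π,π]^ν` is built: the same bound (3.113) is used
through Parseval on the finite torus, which yields a volume-uniform `ℓ²` bound on the part of `T_Λ`
away from the two atoms; in the limit this gives directly what (3.108) is used for in §4 — the
regular part of the infinite-volume two-point function tends to zero at infinity
(`ComplexSpinTwoPointMeasure`).  The density bounds (3.109) on `ĝ` are represented by their
finite-volume form (3.112)–(3.113).  Honest framing: `β = 0` complex spin systems on even tori and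
their pointwise limits; nothing about `β > 0`, the continuum, `SU(N)` or the summit's `QCD` conjunct.

WHAT IS PRINTED (locators).  (3.100)–(3.106) p. 415; Thm. 3.23 (1) with (3.107)–(3.110) pp. 415–416;
proof (3.112)–(3.119) pp. 416–417 ("`|T̂_Λ(k)| ≤ b(k)/2N` (3.113) with
`b(k) = sup{D(k)⁻¹, D(k+π̂)⁻¹}` (3.114). In the thermodynamic limit, `Λ* = ℬ_ν`. For `ν ≥ 3`,
`b ∈ L¹(ℬ_ν)` … so `T̂` is a signed measure by the Riesz-Markov-theorem. Inequality (3.109) follows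
by taking the thermodynamic limit in the infrared bound and using a peaking argument, as in [18].").

## References

* M. Salmhofer, E. Seiler, *Proof of chiral symmetry breaking in strongly coupled lattice gauge
  theory*, Commun. Math. Phys. 139 (1991) 395–432: (3.100)–(3.119), Thm. 3.23. [SalmhoferSeiler1991]
* J. Fröhlich, B. Simon, T. Spencer, Commun. Math. Phys. 50 (1976) 79–95 (the paper's [18]: infrared
  bounds, the peaking argument). [FrohlichSimonSpencer1976]
* S. Friedli, Y. Velenik, *Statistical Mechanics of Lattice Systems*, CUP 2017, §10.5 (characters of
  the torus, Parseval, momentum sums as Riemann sums). [FriedliVelenik2017]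
-/

noncomputable section

open MvPolynomial Finset Filter MeasureTheory
open Literature.Probability.LatticeModels

namespace Literature.MathematicalPhysics.StatisticalMechanics

namespace ComplexSpin

variable {ν L : ℕ}

section Torus

variable [NeZero L]

/-! ### The normalised two-point function `T_Λ`, its zero mode `a_Λ` and staggered mode `b_Λ` -/

/-- The normalised two-point function `T_Λ(x) = ⟨σ_0 σ_x⟩_Λ` of (3.100) (translation invariant,
`T_Λ(x - y) = ⟨σ_y σ_x⟩_Λ`). [cite: SalmhoferSeiler1991, (3.100)] -/
def corrFn (N : ℕ) (m : ℝ) (a : ℕ → ℝ) (x : TorusSite ν L) : ℝ :=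
  expect N m a (X (0 : TorusSite ν L) * X x)

/-- `T_Λ(x) = [σ_0σ_x]_Λ / Z_Λ`. [cite: SalmhoferSeiler1991, (3.100) and (3.2)] -/
theorem corrFn_eq_div (N : ℕ) (m : ℝ) (a : ℕ → ℝ) (x : TorusSite ν L) :
    corrFn N m a x = twoPt N m a 0 x / partitionFunction (ν := ν) (L := L) N m a := by
  rw [corrFn, expect_eq_div]; rfl

/-- The zero mode `a_Λ = |Λ|⁻¹ T̂_Λ(0) = |Λ|⁻¹ ∑_x T_Λ(x)` — the weight of the Dirac mass at `k = 0`
in (3.115), whose limit is `c₀` of (3.108). [cite: SalmhoferSeiler1991, (3.115) and (3.108)] -/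
def zeroMode (N : ℕ) (m : ℝ) (a : ℕ → ℝ) : ℝ :=
  (Fintype.card (TorusSite ν L) : ℝ)⁻¹ * ∑ x : TorusSite ν L, corrFn N m a x

/-- The staggered mode `b_Λ = |Λ|⁻¹ T̂_Λ(π̂) = |Λ|⁻¹ ∑_x ε(x) T_Λ(x)` — the weight of the Dirac mass at
`k = π̂` in (3.115), whose limit is `-c_π̂` of (3.108). [cite: SalmhoferSeiler1991, (3.115) and (3.108)] -/
def stagMode (hL : 2 ∣ L) (N : ℕ) (m : ℝ) (a : ℕ → ℝ) : ℝ :=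
  (Fintype.card (TorusSite ν L) : ℝ)⁻¹ * ∑ x : TorusSite ν L, (sgn hL x : ℝ) * corrFn N m a x

omit [NeZero L] in
/-- `ε(x)` as a complex number is the staggered character. [cite: SalmhoferSeiler1991, (2.8) and (3.101)] -/
theorem stagChar_eq_sgn (hL : 2 ∣ L) (x : TorusSite ν L) :
    stagChar hL x = ((sgn hL x : ℝ) : ℂ) := by
  rw [stagChar_apply]
  unfold sgn
  split_ifs <;> simp

/-- `a_Λ = |Λ|⁻¹ ĝ(0) / Z_Λ`. [cite: SalmhoferSeiler1991, (3.105) and (3.115)] -/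
theorem zeroMode_eq (N : ℕ) (m : ℝ) (a : ℕ → ℝ) :
    zeroMode (ν := ν) (L := L) N m a =
      (Fintype.card (TorusSite ν L) : ℝ)⁻¹ *
        (twoPtHat N m a (0 : AddChar (TorusSite ν L) ℂ) / partitionFunction (ν := ν) (L := L) N m a) := by
  unfold zeroMode twoPtHat kernelSymbol
  rw [Complex.re_sum, Finset.sum_div]
  congr 1
  refine Finset.sum_congr rfl fun z _ => ?_
  rw [AddChar.zero_apply, mul_one, Complex.ofReal_re, corrFn_eq_div]

/-- `b_Λ = |Λ|⁻¹ ĝ(π̂) / Z_Λ`. [cite: SalmhoferSeiler1991, (3.105) and (3.115)] -/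
theorem stagMode_eq (hL : 2 ∣ L) (N : ℕ) (m : ℝ) (a : ℕ → ℝ) :
    stagMode (ν := ν) (L := L) hL N m a =
      (Fintype.card (TorusSite ν L) : ℝ)⁻¹ *
        (twoPtHat N m a (stagChar (ν := ν) (L := L) hL) /
          partitionFunction (ν := ν) (L := L) N m a) := by
  unfold stagMode twoPtHat kernelSymbol
  rw [Complex.re_sum, Finset.sum_div]
  congr 1
  refine Finset.sum_congr rfl fun z _ => ?_
  rw [stagChar_eq_sgn, ← Complex.ofReal_mul, Complex.ofReal_re, corrFn_eq_div]
  ring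

/-! ### The symbols `D(k) = ν - C(k)`, `D(k + π̂) = ν + C(k)` and the cutoff `φ_η` -/

/-- `D(χ) = ν - C(χ) ≥ 0`. [cite: SalmhoferSeiler1991, (3.110)] -/
theorem dispC_nonneg (χ : AddChar (TorusSite ν L) ℂ) : 0 ≤ (ν : ℝ) - cosSum χ :=
  sub_nonneg.2 (cosSum_le χ)

/-- `D(χ + π̂) = ν + C(χ) ≥ 0`. [cite: SalmhoferSeiler1991, (3.112)] -/
theorem dispBar_nonneg (χ : AddChar (TorusSite ν L) ℂ) : 0 ≤ (ν : ℝ) + cosSum χ := by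
  have := neg_le_cosSum χ; linarith

/-- The continuous momentum cutoff `φ_η(k) = min(1, D(k)/η, D(k+π̂)/η) ∈ [0,1]`, vanishing exactly at
`k ∈ {0, π̂}` and equal to `1` where `b(k) = max(D(k)⁻¹, D(k+π̂)⁻¹) ≤ η⁻¹` (3.114): it separates the
two Dirac masses of (3.108) from the absolutely continuous part.  Plumbing for the lattice form of
Thm. 3.23 (1). [cite: SalmhoferSeiler1991, (3.114) and (3.116)] -/
def cutoff (η : ℝ) (χ : AddChar (TorusSite ν L) ℂ) : ℝ :=
  min 1 (min ((ν - cosSum χ) / η) ((ν + cosSum χ) / η))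

/-- `0 ≤ φ_η`. [cite: SalmhoferSeiler1991, (3.114)] -/
theorem cutoff_nonneg {η : ℝ} (hη : 0 < η) (χ : AddChar (TorusSite ν L) ℂ) : 0 ≤ cutoff η χ :=
  le_min zero_le_one (le_min (div_nonneg (dispC_nonneg χ) hη.le) (div_nonneg (dispBar_nonneg χ) hη.le))

omit [NeZero L] in
/-- `φ_η ≤ 1`. [cite: SalmhoferSeiler1991, (3.114)] -/
theorem cutoff_le_one (η : ℝ) (χ : AddChar (TorusSite ν L) ℂ) : cutoff η χ ≤ 1 := min_le_left _ _

omit [NeZero L] in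
/-- `φ_η = min(1, u/η)` with `u = min(D, D̄)`. [cite: SalmhoferSeiler1991, (3.114)] -/
theorem cutoff_eq_min {η : ℝ} (hη : 0 < η) (χ : AddChar (TorusSite ν L) ℂ) :
    cutoff η χ = min 1 (min ((ν : ℝ) - cosSum χ) ((ν : ℝ) + cosSum χ) / η) := by
  unfold cutoff
  rw [min_div_div_right hη.le]

/-- `φ_η(0) = 0`. [cite: SalmhoferSeiler1991, (3.116)] -/
theorem cutoff_zero {η : ℝ} (hη : 0 < η) : cutoff η (0 : AddChar (TorusSite ν L) ℂ) = 0 := by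
  apply le_antisymm _ (cutoff_nonneg hη 0)
  unfold cutoff
  rw [cosSum_zero, sub_self, zero_div]
  exact (min_le_right _ _).trans (min_le_left _ _)

/-- `φ_η(π̂) = 0`. [cite: SalmhoferSeiler1991, (3.116)] -/
theorem cutoff_stagChar {η : ℝ} (hη : 0 < η) (hL : 2 ∣ L) :
    cutoff η (stagChar (ν := ν) (L := L) hL) = 0 := by
  apply le_antisymm _ (cutoff_nonneg hη _)
  unfold cutoff
  rw [cosSum_stagChar, add_neg_cancel, zero_div]
  exact (min_le_right _ _).trans (min_le_right _ _)

/-! ### The infrared bound mode by mode in the form (3.113): `|T̂_Λ(k)| ≤ b(k)/2N` -/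

/-- **(3.113)**: for `k ∉ {0, π̂}`, `|T̂_Λ(k)| ≤ (2N)⁻¹ b(k)` with `b(k) = max(D(k)⁻¹, D(k+π̂)⁻¹) =
(min(D(k), D(k+π̂)))⁻¹` (3.114) — here unnormalised, `|ĝ(χ)|/Z_Λ ≤ 1/(2N min(D, D̄))`, from the two
one-sided mode bounds (3.112). [cite: SalmhoferSeiler1991, (3.113)–(3.114)] -/
theorem abs_twoPtHat_div_le (hL : Even L) (i : Fin ν) (hcard : 2 ≤ Fintype.card (TorusSite ν L))
    {N : ℕ} (hN : 1 ≤ N) (m : ℝ) {a : ℕ → ℝ} (hb : ∀ k ≤ N, 0 ≤ fluctCoeff N a k)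
    {χ : AddChar (TorusSite ν L) ℂ} (h0 : χ ≠ 0) (hπ : χ ≠ stagChar hL.two_dvd) :
    |twoPtHat N m a χ| / partitionFunction (ν := ν) (L := L) N m a ≤
      1 / (2 * N * min ((ν : ℝ) - cosSum χ) ((ν : ℝ) + cosSum χ)) := by
  have hD : 0 < (ν : ℝ) - cosSum χ := sub_pos.2 (cosSum_lt_of_ne_zero h0)
  have hDb : 0 < (ν : ℝ) + cosSum χ := by
    have := neg_lt_cosSum_of_ne_stagChar hL.two_dvd hπ; linarith
  have hu : 0 < min ((ν : ℝ) - cosSum χ) ((ν : ℝ) + cosSum χ) := lt_min hD hDb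
  have hNpos : (0 : ℝ) < N := by exact_mod_cast hN
  have hZ0 : 0 ≤ partitionFunction (ν := ν) (L := L) N m a :=
    (partitionFunction_nonneg' hL i hcard 1 (Or.inl rfl) m hb).1
  have h1 := twoPtHat_mode_le hL i hcard hN m hb χ
  have h2 := neg_twoPtHat_mode_le hL i hcard hN m hb χ
  set Z := partitionFunction (ν := ν) (L := L) N m a with hZdef
  set g := twoPtHat N m a χ
  set u := min ((ν : ℝ) - cosSum χ) ((ν : ℝ) + cosSum χ) with hudef
  -- `2 u |g| ≤ Z / N`
  have key : 2 * u * |g| ≤ 1 / N * Z := by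
    rcases le_or_gt 0 g with hg | hg
    · rw [abs_of_nonneg hg]
      calc 2 * u * g ≤ 2 * ((ν : ℝ) - cosSum χ) * g := by
            have := min_le_left ((ν : ℝ) - cosSum χ) ((ν : ℝ) + cosSum χ)
            nlinarith
        _ ≤ 1 / N * Z := h1
    · rw [abs_of_neg hg]
      calc 2 * u * -g ≤ 2 * ((ν : ℝ) + cosSum χ) * -g := by
            have := min_le_right ((ν : ℝ) - cosSum χ) ((ν : ℝ) + cosSum χ)
            nlinarith
        _ ≤ 1 / N * Z := h2
  rcases hZ0.eq_or_lt with hZ | hZ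
  · rw [← hZ, div_zero]; positivity
  · rw [div_le_iff₀ hZ, div_mul_eq_mul_div, le_div_iff₀ (by positivity), one_mul]
    calc |g| * (2 * N * u) = N * (2 * u * |g|) := by ring
      _ ≤ N * (1 / N * Z) := mul_le_mul_of_nonneg_left key hNpos.le
      _ = Z := by field_simp

/-- The far modes carry at most `(2Nη)⁻¹` each: `φ_η(k) |T̂_Λ(k)| ≤ (2Nη)⁻¹` for EVERY `k`
(including `0` and `π̂`, where `φ_η = 0`). [cite: SalmhoferSeiler1991, (3.113)–(3.116)] -/
theorem cutoff_mul_abs_twoPtHat_div_le (hL : Even L) (i : Fin ν)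
    (hcard : 2 ≤ Fintype.card (TorusSite ν L)) {N : ℕ} (hN : 1 ≤ N) (m : ℝ) {a : ℕ → ℝ}
    (hb : ∀ k ≤ N, 0 ≤ fluctCoeff N a k) {η : ℝ} (hη : 0 < η) (χ : AddChar (TorusSite ν L) ℂ) :
    cutoff η χ * (|twoPtHat N m a χ| / partitionFunction (ν := ν) (L := L) N m a) ≤
      1 / (2 * N * η) := by
  have hNpos : (0 : ℝ) < N := by exact_mod_cast hN
  by_cases h0 : χ = 0
  · subst h0; rw [cutoff_zero hη, zero_mul]; positivity
  by_cases hπ : χ = stagChar hL.two_dvd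
  · subst hπ; rw [cutoff_stagChar hη, zero_mul]; positivity
  have hD : 0 < (ν : ℝ) - cosSum χ := sub_pos.2 (cosSum_lt_of_ne_zero h0)
  have hDb : 0 < (ν : ℝ) + cosSum χ := by
    have := neg_lt_cosSum_of_ne_stagChar hL.two_dvd hπ; linarith
  set u := min ((ν : ℝ) - cosSum χ) ((ν : ℝ) + cosSum χ) with hudef
  have hu : 0 < u := lt_min hD hDb
  have ht := abs_twoPtHat_div_le hL i hcard hN m hb h0 hπ
  have hφ : cutoff η χ ≤ u / η := by rw [cutoff_eq_min hη]; exact min_le_right _ _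
  have ht0 : 0 ≤ |twoPtHat N m a χ| / partitionFunction (ν := ν) (L := L) N m a :=
    div_nonneg (abs_nonneg _) (partitionFunction_nonneg' hL i hcard 1 (Or.inl rfl) m hb).1
  calc cutoff η χ * (|twoPtHat N m a χ| / partitionFunction (ν := ν) (L := L) N m a)
      ≤ (u / η) * (1 / (2 * N * u)) :=
        mul_le_mul hφ ht ht0 (div_nonneg hu.le hη.le)
    _ = 1 / (2 * N * η) := by field_simp

/-- The near modes: for `k ∉ {0, π̂}`,
`(1 - φ_η(k)) |T̂_Λ(k)| ≤ (2N)⁻¹ ((D(k)⁻¹ - η⁻¹)⁺ + (D(k+π̂)⁻¹ - η⁻¹)⁺)`.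
[cite: SalmhoferSeiler1991, (3.113)–(3.116)] -/
theorem one_sub_cutoff_mul_abs_twoPtHat_div_le (hL : Even L) (i : Fin ν)
    (hcard : 2 ≤ Fintype.card (TorusSite ν L)) {N : ℕ} (hN : 1 ≤ N) (m : ℝ) {a : ℕ → ℝ}
    (hb : ∀ k ≤ N, 0 ≤ fluctCoeff N a k) {η : ℝ} (hη : 0 < η) {χ : AddChar (TorusSite ν L) ℂ}
    (h0 : χ ≠ 0) (hπ : χ ≠ stagChar hL.two_dvd) :
    (1 - cutoff η χ) * (|twoPtHat N m a χ| / partitionFunction (ν := ν) (L := L) N m a) ≤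
      1 / (2 * N) * (max (1 / ((ν : ℝ) - cosSum χ) - 1 / η) 0 +
        max (1 / ((ν : ℝ) + cosSum χ) - 1 / η) 0) := by
  have hNpos : (0 : ℝ) < N := by exact_mod_cast hN
  have hD : 0 < (ν : ℝ) - cosSum χ := sub_pos.2 (cosSum_lt_of_ne_zero h0)
  have hDb : 0 < (ν : ℝ) + cosSum χ := by
    have := neg_lt_cosSum_of_ne_stagChar hL.two_dvd hπ; linarith
  set D := (ν : ℝ) - cosSum χ with hDdef
  set Db := (ν : ℝ) + cosSum χ with hDbdef
  set u := min D Db with hudef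
  have hu : 0 < u := lt_min hD hDb
  have ht := abs_twoPtHat_div_le hL i hcard hN m hb h0 hπ
  set t := |twoPtHat N m a χ| / partitionFunction (ν := ν) (L := L) N m a with htdef
  have ht0 : 0 ≤ t :=
    div_nonneg (abs_nonneg _) (partitionFunction_nonneg' hL i hcard 1 (Or.inl rfl) m hb).1
  have hP0 : 0 ≤ max (1 / D - 1 / η) 0 := le_max_right _ _
  have hQ0 : 0 ≤ max (1 / Db - 1 / η) 0 := le_max_right _ _
  -- `1/u - 1/η ≤ (1/D - 1/η)⁺ + (1/D̄ - 1/η)⁺`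
  have hsum : 1 / u - 1 / η ≤ max (1 / D - 1 / η) 0 + max (1 / Db - 1 / η) 0 := by
    rcases le_total D Db with h | h
    · rw [hudef, min_eq_left h]
      linarith [le_max_left (1 / D - 1 / η) 0]
    · rw [hudef, min_eq_right h]
      linarith [le_max_left (1 / Db - 1 / η) 0]
  rcases le_or_gt η u with hηu | hηu
  · -- far mode: `φ = 1`
    have hφ : cutoff η χ = 1 := by
      rw [cutoff_eq_min hη, ← hDdef, ← hDbdef, ← hudef, min_eq_left]
      rw [le_div_iff₀ hη, one_mul]; exact hηu
    rw [hφ, sub_self, zero_mul]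
    positivity
  · -- near mode: `φ = u/η`
    have hφ : cutoff η χ = u / η := by
      rw [cutoff_eq_min hη, ← hDdef, ← hDbdef, ← hudef, min_eq_right]
      rw [div_le_iff₀ hη, one_mul]; exact hηu.le
    rw [hφ]
    have h1 : 0 ≤ 1 - u / η := by
      rw [sub_nonneg, div_le_iff₀ hη, one_mul]; exact hηu.le
    calc (1 - u / η) * t ≤ (1 - u / η) * (1 / (2 * N * u)) :=
          mul_le_mul_of_nonneg_left ht h1
      _ = 1 / (2 * N) * (1 / u - 1 / η) := by field_simp
      _ ≤ 1 / (2 * N) * (max (1 / D - 1 / η) 0 + max (1 / Db - 1 / η) 0) :=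
          mul_le_mul_of_nonneg_left hsum (by positivity)


/-! ### Fourier inversion (3.104): `T_Λ = a_Λ + b_Λ ε + |Λ|⁻¹ ∑_{k ∉ {0,π̂}} T̂_Λ(k) e^{-ikx}` -/

/-- The regular modes `Λ* ∖ {0, π̂}`. [cite: SalmhoferSeiler1991, (3.116)] -/
def regularModes (hL : 2 ∣ L) : Finset (AddChar (TorusSite ν L) ℂ) :=
  ((Finset.univ.erase 0).erase (stagChar hL))

/-- Membership in `Λ* ∖ {0, π̂}`. [cite: SalmhoferSeiler1991, (3.116)] -/
theorem mem_regularModes {hL : 2 ∣ L} {χ : AddChar (TorusSite ν L) ℂ} :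
    χ ∈ regularModes hL ↔ χ ≠ 0 ∧ χ ≠ stagChar hL := by
  simp [regularModes, and_comm]

/-- `T_Λ(ξ) = |Λ|⁻¹ ∑_χ T̂_Λ(χ) conj χ(ξ)` (3.104), normalised. [cite: SalmhoferSeiler1991, (3.104)] -/
theorem corrFn_eq_sum (N : ℕ) (m : ℝ) (a : ℕ → ℝ) (ξ : TorusSite ν L) :
    ((corrFn N m a ξ : ℝ) : ℂ) = (Fintype.card (TorusSite ν L) : ℂ)⁻¹ *
      ∑ χ : AddChar (TorusSite ν L) ℂ,
        (((twoPtHat N m a χ / partitionFunction (ν := ν) (L := L) N m a : ℝ) : ℂ) *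
          starRingEnd ℂ (χ ξ)) := by
  have hn : (Fintype.card (TorusSite ν L) : ℂ) ≠ 0 := Nat.cast_ne_zero.2 Fintype.card_ne_zero
  have h := card_mul_twoPt_eq N m a ξ
  simp_rw [kernelSymbol_twoPt] at h
  rw [corrFn_eq_div, Complex.ofReal_div]
  have : ((twoPt N m a 0 ξ : ℝ) : ℂ) = (Fintype.card (TorusSite ν L) : ℂ)⁻¹ *
      ∑ χ : AddChar (TorusSite ν L) ℂ, ((twoPtHat N m a χ : ℝ) : ℂ) * starRingEnd ℂ (χ ξ) := by
    rw [← h, ← mul_assoc, inv_mul_cancel₀ hn, one_mul]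
  rw [this, mul_div_assoc, Finset.sum_div]
  congr 1
  refine Finset.sum_congr rfl fun χ _ => ?_
  rw [Complex.ofReal_div]
  ring

/-- **(3.104) with the two Dirac modes separated**:
`T_Λ(ξ) = a_Λ + b_Λ ε(ξ) + |Λ|⁻¹ ∑_{χ ∉ {0, ε}} T̂_Λ(χ) conj χ(ξ)` — the finite-volume form of the
decomposition `T̂ = c₀δ₀ - c_π̂δ_π̂ + ĝ` (3.108)/(3.115). [cite: SalmhoferSeiler1991, (3.104), (3.108) and (3.115)] -/
theorem corrFn_decomp (hL : 2 ∣ L) (hν : 1 ≤ ν) (N : ℕ) (m : ℝ) (a : ℕ → ℝ) (ξ : TorusSite ν L) :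
    ((corrFn N m a ξ : ℝ) : ℂ) = (zeroMode (ν := ν) (L := L) N m a : ℂ) +
      (stagMode (ν := ν) (L := L) hL N m a : ℂ) * ((sgn hL ξ : ℝ) : ℂ) +
      (Fintype.card (TorusSite ν L) : ℂ)⁻¹ * ∑ χ ∈ regularModes hL,
        (((twoPtHat N m a χ / partitionFunction (ν := ν) (L := L) N m a : ℝ) : ℂ) *
          starRingEnd ℂ (χ ξ)) := by
  classical
  rw [corrFn_eq_sum]
  have hst : stagChar (ν := ν) (L := L) hL ∈ Finset.univ.erase (0 : AddChar (TorusSite ν L) ℂ) :=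
    Finset.mem_erase.2 ⟨stagChar_ne_zero hL hν, Finset.mem_univ _⟩
  rw [← Finset.sum_erase_add _ _ (Finset.mem_univ (0 : AddChar (TorusSite ν L) ℂ)),
    ← Finset.sum_erase_add _ _ hst, regularModes]
  rw [AddChar.zero_apply, map_one, mul_one, stagChar_eq_sgn, Complex.conj_ofReal,
    zeroMode_eq, stagMode_eq]
  push_cast
  ring

/-! ### The far part (Parseval) and the near part (a momentum sum) of the remainder -/

/-- The **far part** of the remainder: `F_Λ(ξ) = |Λ|⁻¹ ∑_χ φ_η(χ) T̂_Λ(χ) conj χ(ξ)` (the modes with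
`b(k) ≲ η⁻¹`, weighted continuously). [cite: SalmhoferSeiler1991, (3.116)] -/
def farPart (η : ℝ) (N : ℕ) (m : ℝ) (a : ℕ → ℝ) (ξ : TorusSite ν L) : ℂ :=
  (Fintype.card (TorusSite ν L) : ℂ)⁻¹ * ∑ χ : AddChar (TorusSite ν L) ℂ,
    (((cutoff η χ * (twoPtHat N m a χ / partitionFunction (ν := ν) (L := L) N m a) : ℝ) : ℂ) *
      starRingEnd ℂ (χ ξ))

/-- The **near bound** `n_Λ(η) = N⁻¹ |Λ|⁻¹ ∑_{χ} (D(χ)⁻¹ - η⁻¹)⁺` controlling the modes near the two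
Dirac masses (`|Λ|⁻¹ ∑_{k ∉ {0,π̂}} b(k)` of (3.116), cut off at height `η⁻¹`; the `k = 0` term is
`0` by the convention `0⁻¹ = 0`). [cite: SalmhoferSeiler1991, (3.116) and (3.118)] -/
def nearBound (ν L : ℕ) [NeZero L] (η : ℝ) (N : ℕ) : ℝ :=
  1 / N * ((Fintype.card (TorusSite ν L) : ℝ)⁻¹ *
    ∑ χ : AddChar (TorusSite ν L) ℂ, max (1 / ((ν : ℝ) - cosSum χ) - 1 / η) 0)

/-- `n_Λ(η) ≥ 0`. [cite: SalmhoferSeiler1991, (3.116)] -/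
theorem nearBound_nonneg (η : ℝ) (N : ℕ) : 0 ≤ nearBound ν L η N := by
  unfold nearBound
  exact mul_nonneg (by positivity) (mul_nonneg (by positivity)
    (Finset.sum_nonneg fun χ _ => le_max_right _ _))

/-- The antiferromagnetic modes fold onto the ferromagnetic ones under `χ ↦ ε + χ`:
`∑_χ (D(χ+π̂)⁻¹ - η⁻¹)⁺ = ∑_χ (D(χ)⁻¹ - η⁻¹)⁺` ((4.14): `C(k+π̂) = -C(k)`). [cite: SalmhoferSeiler1991, (4.14)] -/
theorem sum_posPart_dispBar_eq (hL : 2 ∣ L) (η : ℝ) :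
    ∑ χ : AddChar (TorusSite ν L) ℂ, max (1 / ((ν : ℝ) + cosSum χ) - 1 / η) 0 =
      ∑ χ : AddChar (TorusSite ν L) ℂ, max (1 / ((ν : ℝ) - cosSum χ) - 1 / η) 0 := by
  refine (Fintype.sum_equiv (Equiv.addLeft (stagChar hL)) _ _ fun χ => ?_).symm
  simp only [Equiv.coe_addLeft, cosSum_stagChar_add, ← sub_eq_add_neg]

/-- The far part lives on the regular modes (`φ_η(0) = φ_η(π̂) = 0`). [cite: SalmhoferSeiler1991, (3.116)] -/
theorem farPart_eq_sum_regular (hL : 2 ∣ L) (hν : 1 ≤ ν) {η : ℝ} (hη : 0 < η) (N : ℕ) (m : ℝ)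
    (a : ℕ → ℝ) (ξ : TorusSite ν L) :
    farPart η N m a ξ = (Fintype.card (TorusSite ν L) : ℂ)⁻¹ * ∑ χ ∈ regularModes hL,
      (((cutoff η χ * (twoPtHat N m a χ / partitionFunction (ν := ν) (L := L) N m a) : ℝ) : ℂ) *
        starRingEnd ℂ (χ ξ)) := by
  classical
  unfold farPart regularModes
  congr 1
  have hst : stagChar (ν := ν) (L := L) hL ∈ Finset.univ.erase (0 : AddChar (TorusSite ν L) ℂ) :=
    Finset.mem_erase.2 ⟨stagChar_ne_zero hL hν, Finset.mem_univ _⟩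
  rw [← Finset.sum_erase_add _ _ (Finset.mem_univ (0 : AddChar (TorusSite ν L) ℂ)),
    ← Finset.sum_erase_add _ _ hst, cutoff_zero hη, cutoff_stagChar hη]
  simp

/-- **The near part is small in sup norm**: for every site `ξ`,
`|T_Λ(ξ) - a_Λ - b_Λ ε(ξ) - F_Λ(ξ)| ≤ n_Λ(η)` ((3.116): the modes near `0` and `π̂` are bounded by
`|Λ|⁻¹ ∑ b(k)` over those modes). [cite: SalmhoferSeiler1991, (3.113)–(3.116)] -/
theorem norm_remainder_sub_farPart_le (hL : Even L) (hν : 1 ≤ ν) (i : Fin ν)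
    (hcard : 2 ≤ Fintype.card (TorusSite ν L)) {N : ℕ} (hN : 1 ≤ N) (m : ℝ) {a : ℕ → ℝ}
    (hb : ∀ k ≤ N, 0 ≤ fluctCoeff N a k) {η : ℝ} (hη : 0 < η) (ξ : TorusSite ν L) :
    ‖((corrFn N m a ξ : ℝ) : ℂ) - (zeroMode (ν := ν) (L := L) N m a : ℂ) -
        (stagMode (ν := ν) (L := L) hL.two_dvd N m a : ℂ) * ((sgn hL.two_dvd ξ : ℝ) : ℂ) -
        farPart η N m a ξ‖ ≤ nearBound ν L η N := by
  classical
  have hNpos : (0 : ℝ) < N := by exact_mod_cast hN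
  have hZ0 : 0 ≤ partitionFunction (ν := ν) (L := L) N m a :=
    (partitionFunction_nonneg' hL i hcard 1 (Or.inl rfl) m hb).1
  set Z := partitionFunction (ν := ν) (L := L) N m a with hZdef
  set c : ℝ := (Fintype.card (TorusSite ν L) : ℝ)⁻¹ with hcdef
  have hc0 : 0 ≤ c := by positivity
  have hcC : (Fintype.card (TorusSite ν L) : ℂ)⁻¹ = ((c : ℝ) : ℂ) := by
    rw [hcdef, Complex.ofReal_inv, Complex.ofReal_natCast]
  rw [corrFn_decomp hL.two_dvd hν, farPart_eq_sum_regular hL.two_dvd hν hη, hcC]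
  -- the difference is `c ∑_{regular} (1 - φ) (ĝ/Z) conj χ(ξ)`
  have hdiff : ((zeroMode (ν := ν) (L := L) N m a : ℝ) : ℂ) +
      ((stagMode (ν := ν) (L := L) hL.two_dvd N m a : ℝ) : ℂ) * ((sgn hL.two_dvd ξ : ℝ) : ℂ) +
      ((c : ℝ) : ℂ) * ∑ χ ∈ regularModes hL.two_dvd,
        (((twoPtHat N m a χ / Z : ℝ) : ℂ) * starRingEnd ℂ (χ ξ)) -
      ((zeroMode (ν := ν) (L := L) N m a : ℝ) : ℂ) -
      ((stagMode (ν := ν) (L := L) hL.two_dvd N m a : ℝ) : ℂ) * ((sgn hL.two_dvd ξ : ℝ) : ℂ) -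
      ((c : ℝ) : ℂ) * ∑ χ ∈ regularModes hL.two_dvd,
        (((cutoff η χ * (twoPtHat N m a χ / Z) : ℝ) : ℂ) * starRingEnd ℂ (χ ξ)) =
      ((c : ℝ) : ℂ) * ∑ χ ∈ regularModes hL.two_dvd,
        ((((1 - cutoff η χ) * (twoPtHat N m a χ / Z) : ℝ) : ℂ) * starRingEnd ℂ (χ ξ)) := by
    rw [show ∀ (A B S₁ S₂ cc : ℂ), A + B + cc * S₁ - A - B - cc * S₂ = cc * (S₁ - S₂) from
      fun A B S₁ S₂ cc => by ring, ← Finset.sum_sub_distrib]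
    congr 1
    refine Finset.sum_congr rfl fun χ _ => ?_
    push_cast
    ring
  rw [hdiff, norm_mul, Complex.norm_real, Real.norm_of_nonneg hc0]
  -- termwise bound
  have hterm : ∀ χ ∈ regularModes hL.two_dvd,
      ‖((((1 - cutoff η χ) * (twoPtHat N m a χ / Z) : ℝ) : ℂ) * starRingEnd ℂ (χ ξ))‖ ≤
        1 / (2 * N) * (max (1 / ((ν : ℝ) - cosSum χ) - 1 / η) 0 +
          max (1 / ((ν : ℝ) + cosSum χ) - 1 / η) 0) := by
    intro χ hχ
    rw [mem_regularModes] at hχ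
    rw [norm_mul, Complex.norm_real, RCLike.norm_conj, AddChar.norm_apply, mul_one,
      Real.norm_eq_abs, abs_mul, abs_of_nonneg (sub_nonneg.2 (cutoff_le_one η χ)), abs_div,
      abs_of_nonneg hZ0]
    exact one_sub_cutoff_mul_abs_twoPtHat_div_le hL i hcard hN m hb hη hχ.1 hχ.2
  calc c * ‖∑ χ ∈ regularModes hL.two_dvd,
          ((((1 - cutoff η χ) * (twoPtHat N m a χ / Z) : ℝ) : ℂ) * starRingEnd ℂ (χ ξ))‖
      ≤ c * ∑ χ ∈ regularModes hL.two_dvd,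
          1 / (2 * N) * (max (1 / ((ν : ℝ) - cosSum χ) - 1 / η) 0 +
            max (1 / ((ν : ℝ) + cosSum χ) - 1 / η) 0) :=
        mul_le_mul_of_nonneg_left ((norm_sum_le _ _).trans (Finset.sum_le_sum hterm)) hc0
    _ ≤ c * ∑ χ : AddChar (TorusSite ν L) ℂ,
          1 / (2 * N) * (max (1 / ((ν : ℝ) - cosSum χ) - 1 / η) 0 +
            max (1 / ((ν : ℝ) + cosSum χ) - 1 / η) 0) := by
        exact mul_le_mul_of_nonneg_left (Finset.sum_le_sum_of_subset_of_nonneg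
          (Finset.subset_univ _) fun χ _ _ => by positivity) hc0
    _ = nearBound ν L η N := by
        rw [← Finset.mul_sum, Finset.sum_add_distrib, sum_posPart_dispBar_eq hL.two_dvd, nearBound,
          hcdef]
        ring

/-- **Parseval for a character sum**: `∑_ξ |∑_χ c(χ) conj χ(ξ)|² = |Λ| ∑_χ |c(χ)|²`
(orthogonality of the characters of `Λ`). [cite: FriedliVelenik2017, §10.5.3 (proof of Thm. 10.24)] -/
theorem sum_norm_sq_charSum (c : AddChar (TorusSite ν L) ℂ → ℂ) :
    ∑ ξ : TorusSite ν L, ‖∑ χ : AddChar (TorusSite ν L) ℂ, c χ * starRingEnd ℂ (χ ξ)‖ ^ 2 =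
      Fintype.card (TorusSite ν L) * ∑ χ : AddChar (TorusSite ν L) ℂ, ‖c χ‖ ^ 2 := by
  classical
  apply Complex.ofReal_injective
  push_cast
  have h1 : ∀ ξ : TorusSite ν L,
      ((‖∑ χ : AddChar (TorusSite ν L) ℂ, c χ * starRingEnd ℂ (χ ξ)‖ : ℝ) : ℂ) ^ 2 =
        ∑ ψ : AddChar (TorusSite ν L) ℂ, ∑ χ : AddChar (TorusSite ν L) ℂ,
          starRingEnd ℂ (c ψ) * c χ * (starRingEnd ℂ (χ ξ) * ψ ξ) := by
    intro ξ
    rw [← Complex.conj_mul', map_sum, Finset.sum_mul_sum]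
    refine Finset.sum_congr rfl fun ψ _ => Finset.sum_congr rfl fun χ _ => ?_
    rw [map_mul, Complex.conj_conj]
    ring
  simp_rw [h1]
  rw [Finset.sum_comm]
  have h2 : ∀ ψ : AddChar (TorusSite ν L) ℂ,
      ∑ ξ : TorusSite ν L, ∑ χ : AddChar (TorusSite ν L) ℂ,
        starRingEnd ℂ (c ψ) * c χ * (starRingEnd ℂ (χ ξ) * ψ ξ) =
        starRingEnd ℂ (c ψ) * c ψ * Fintype.card (TorusSite ν L) := by
    intro ψ
    rw [Finset.sum_comm]
    have h3 : ∀ χ : AddChar (TorusSite ν L) ℂ,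
        ∑ ξ : TorusSite ν L, starRingEnd ℂ (c ψ) * c χ * (starRingEnd ℂ (χ ξ) * ψ ξ) =
          starRingEnd ℂ (c ψ) * c χ * (if χ = ψ then (Fintype.card (TorusSite ν L) : ℂ) else 0) := by
      intro χ
      rw [← Finset.mul_sum, ← fcoeff_addChar ψ χ, fcoeff]
    simp_rw [h3, mul_ite, mul_zero]
    rw [Finset.sum_ite_eq' Finset.univ ψ, if_pos (Finset.mem_univ ψ)]
  simp_rw [h2]
  rw [← Finset.sum_mul, mul_comm]
  congr 1
  refine Finset.sum_congr rfl fun ψ _ => ?_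
  rw [Complex.conj_mul']

/-- **The far part is uniformly square-summable** (Parseval + (3.113)):
`∑_{ξ ∈ Λ} |F_Λ(ξ)|² = |Λ|⁻¹ ∑_χ φ_η(χ)² T̂_Λ(χ)² ≤ (2Nη)⁻²`, uniformly in the volume.
[cite: SalmhoferSeiler1991, (3.113)–(3.116)] -/
theorem sum_norm_sq_farPart_le (hL : Even L) (i : Fin ν) (hcard : 2 ≤ Fintype.card (TorusSite ν L))
    {N : ℕ} (hN : 1 ≤ N) (m : ℝ) {a : ℕ → ℝ} (hb : ∀ k ≤ N, 0 ≤ fluctCoeff N a k)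
    {η : ℝ} (hη : 0 < η) :
    ∑ ξ : TorusSite ν L, ‖farPart η N m a ξ‖ ^ 2 ≤ (1 / (2 * N * η)) ^ 2 := by
  classical
  have hNpos : (0 : ℝ) < N := by exact_mod_cast hN
  have hZ0 : 0 ≤ partitionFunction (ν := ν) (L := L) N m a :=
    (partitionFunction_nonneg' hL i hcard 1 (Or.inl rfl) m hb).1
  set Z := partitionFunction (ν := ν) (L := L) N m a with hZdef
  set n : ℝ := (Fintype.card (TorusSite ν L) : ℝ) with hndef
  have hnpos : 0 < n := by rw [hndef]; exact_mod_cast Fintype.card_pos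
  -- `F = ∑_χ c χ conj χ(ξ)` with `c χ = n⁻¹ φ ĝ/Z`
  set c : AddChar (TorusSite ν L) ℂ → ℂ := fun χ =>
    (Fintype.card (TorusSite ν L) : ℂ)⁻¹ * (((cutoff η χ * (twoPtHat N m a χ / Z) : ℝ) : ℂ)) with hc
  have hF : ∀ ξ, farPart η N m a ξ = ∑ χ, c χ * starRingEnd ℂ (χ ξ) := by
    intro ξ
    rw [farPart, Finset.mul_sum]
    exact Finset.sum_congr rfl fun χ _ => by rw [hc, mul_assoc]
  simp_rw [hF]
  rw [sum_norm_sq_charSum]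
  have hcn : ∀ χ, ‖c χ‖ ^ 2 ≤ n⁻¹ ^ 2 * (1 / (2 * N * η)) ^ 2 := by
    intro χ
    rw [hc]
    dsimp only
    rw [norm_mul, norm_inv, Complex.norm_natCast, Complex.norm_real, Real.norm_eq_abs, mul_pow,
      ← hndef, abs_mul, abs_of_nonneg (cutoff_nonneg hη χ), abs_div, abs_of_nonneg hZ0]
    exact mul_le_mul_of_nonneg_left (pow_le_pow_left₀
      (mul_nonneg (cutoff_nonneg hη χ) (div_nonneg (abs_nonneg _) hZ0))
      (cutoff_mul_abs_twoPtHat_div_le hL i hcard hN m hb hη χ) 2) (by positivity)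
  calc n * ∑ χ : AddChar (TorusSite ν L) ℂ, ‖c χ‖ ^ 2
      ≤ n * ∑ _χ : AddChar (TorusSite ν L) ℂ, n⁻¹ ^ 2 * (1 / (2 * N * η)) ^ 2 :=
        mul_le_mul_of_nonneg_left (Finset.sum_le_sum fun χ _ => hcn χ) hnpos.le
    _ = (1 / (2 * N * η)) ^ 2 := by
        rw [Finset.sum_const, Finset.card_univ, AddChar.card_eq, nsmul_eq_mul, ← hndef]
        field_simp

/-- **The remainder beyond the near bound is square-summable, uniformly in `Λ`**: for every finite set
`S` of sites, `∑_{ξ ∈ S} ((|T_Λ(ξ) - a_Λ - b_Λ ε(ξ)| - n_Λ(η))⁺)² ≤ (2Nη)⁻²`.  This is the lattice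
content of "`ĝ` is absolutely continuous" in Thm. 3.23 (1): the part of `T_Λ` not carried by the two
Dirac masses has, up to the uniformly small error `n_Λ(η)`, an `ℓ²` norm bounded uniformly in the
volume. [cite: SalmhoferSeiler1991, Thm. 3.23 (1) with (3.113)–(3.116)] -/
theorem sum_sq_posPart_remainder_le (hL : Even L) (hν : 1 ≤ ν) (i : Fin ν)
    (hcard : 2 ≤ Fintype.card (TorusSite ν L)) {N : ℕ} (hN : 1 ≤ N) (m : ℝ) {a : ℕ → ℝ}
    (hb : ∀ k ≤ N, 0 ≤ fluctCoeff N a k) {η : ℝ} (hη : 0 < η) (S : Finset (TorusSite ν L)) :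
    ∑ ξ ∈ S, (max (|corrFn N m a ξ - zeroMode (ν := ν) (L := L) N m a -
        stagMode (ν := ν) (L := L) hL.two_dvd N m a * sgn hL.two_dvd ξ| - nearBound ν L η N) 0) ^ 2 ≤
      (1 / (2 * N * η)) ^ 2 := by
  classical
  have hpt : ∀ ξ : TorusSite ν L,
      max (|corrFn N m a ξ - zeroMode (ν := ν) (L := L) N m a -
        stagMode (ν := ν) (L := L) hL.two_dvd N m a * sgn hL.two_dvd ξ| - nearBound ν L η N) 0 ≤
        ‖farPart η N m a ξ‖ := by
    intro ξ
    refine max_le ?_ (norm_nonneg _)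
    have h := norm_remainder_sub_farPart_le hL hν i hcard hN m hb hη ξ
    set r : ℝ := corrFn N m a ξ - zeroMode (ν := ν) (L := L) N m a -
      stagMode (ν := ν) (L := L) hL.two_dvd N m a * sgn hL.two_dvd ξ with hr
    have hrC : ((corrFn N m a ξ : ℝ) : ℂ) - (zeroMode (ν := ν) (L := L) N m a : ℂ) -
        (stagMode (ν := ν) (L := L) hL.two_dvd N m a : ℂ) * ((sgn hL.two_dvd ξ : ℝ) : ℂ) =
        ((r : ℝ) : ℂ) := by
      rw [hr]; push_cast; ring
    rw [hrC] at h
    have : |r| ≤ ‖((r : ℝ) : ℂ) - farPart η N m a ξ‖ + ‖farPart η N m a ξ‖ := by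
      rw [← Real.norm_eq_abs, ← Complex.norm_real (r := r)]
      calc ‖((r : ℝ) : ℂ)‖ = ‖(((r : ℝ) : ℂ) - farPart η N m a ξ) + farPart η N m a ξ‖ := by
            rw [sub_add_cancel]
        _ ≤ ‖((r : ℝ) : ℂ) - farPart η N m a ξ‖ + ‖farPart η N m a ξ‖ := norm_add_le _ _
    linarith
  calc ∑ ξ ∈ S, (max (|corrFn N m a ξ - zeroMode (ν := ν) (L := L) N m a -
        stagMode (ν := ν) (L := L) hL.two_dvd N m a * sgn hL.two_dvd ξ| - nearBound ν L η N) 0) ^ 2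
      ≤ ∑ ξ ∈ S, ‖farPart η N m a ξ‖ ^ 2 :=
        Finset.sum_le_sum fun ξ _ => pow_le_pow_left₀ (le_max_right _ _) (hpt ξ) 2
    _ ≤ ∑ ξ : TorusSite ν L, ‖farPart η N m a ξ‖ ^ 2 :=
        Finset.sum_le_sum_of_subset_of_nonneg (Finset.subset_univ S) fun ξ _ _ => by positivity
    _ ≤ (1 / (2 * N * η)) ^ 2 := sum_norm_sq_farPart_le hL i hcard hN m hb hη

/-! ### Signs and sizes of the two atoms -/

/-- **`c₀ ≥ 0` in finite volume**: `a_Λ ≥ -(4νN|Λ|)⁻¹` (the lower infrared bound (3.112) at `k = 0`,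
where `D(π̂) = 2ν`: the negative part of `T̂` is bounded near `k = 0`, so the atom at `0` is
nonnegative — the "peaking argument"). [cite: SalmhoferSeiler1991, Thm. 3.23 (1) (c₀ ≥ 0) with (3.112)] -/
theorem neg_le_zeroMode (hL : Even L) (hν : 1 ≤ ν) (i : Fin ν)
    (hcard : 2 ≤ Fintype.card (TorusSite ν L)) {N : ℕ} (hN : 1 ≤ N) (m : ℝ) {a : ℕ → ℝ}
    (hb : ∀ k ≤ N, 0 ≤ fluctCoeff N a k) :
    -((Fintype.card (TorusSite ν L) : ℝ)⁻¹ * (1 / (4 * ν * N))) ≤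
      zeroMode (ν := ν) (L := L) N m a := by
  have hNpos : (0 : ℝ) < N := by exact_mod_cast hN
  have hνpos : (0 : ℝ) < ν := by exact_mod_cast hν
  have hZ0 : 0 ≤ partitionFunction (ν := ν) (L := L) N m a :=
    (partitionFunction_nonneg' hL i hcard 1 (Or.inl rfl) m hb).1
  have h2 := neg_twoPtHat_mode_le hL i hcard hN m hb (0 : AddChar (TorusSite ν L) ℂ)
  rw [cosSum_zero] at h2
  rw [zeroMode_eq, neg_mul_eq_mul_neg]
  refine mul_le_mul_of_nonneg_left ?_ (by positivity)
  set Z := partitionFunction (ν := ν) (L := L) N m a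
  set g := twoPtHat N m a (0 : AddChar (TorusSite ν L) ℂ)
  rcases hZ0.eq_or_lt with hZ | hZ
  · rw [← hZ, div_zero]
    have : 0 ≤ 1 / (4 * (ν : ℝ) * N) := by positivity
    linarith
  · have h4ν : (0 : ℝ) < 4 * ν * N := by positivity
    have h3 : -g * (4 * ν * N) ≤ Z := by
      calc -g * (4 * ν * N) = N * (2 * ((ν : ℝ) + ν) * -g) := by ring
        _ ≤ N * (1 / N * Z) := mul_le_mul_of_nonneg_left h2 hNpos.le
        _ = Z := by field_simp
    have h4 : -g ≤ Z / (4 * ν * N) := by rw [le_div_iff₀ h4ν]; exact h3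
    rw [le_div_iff₀ hZ]
    have h5 : -(1 / (4 * (ν : ℝ) * N)) * Z = -(Z / (4 * ν * N)) := by ring
    rw [h5]
    linarith

/-- **`c_π̂ ≥ 0` in finite volume**: `b_Λ ≤ (4νN|Λ|)⁻¹` (the upper infrared bound (3.112) at
`k = π̂`, `D(π̂) = 2ν`). [cite: SalmhoferSeiler1991, Thm. 3.23 (1) (c_π̂ ≥ 0) with (3.112)] -/
theorem stagMode_le (hL : Even L) (hν : 1 ≤ ν) (i : Fin ν)
    (hcard : 2 ≤ Fintype.card (TorusSite ν L)) {N : ℕ} (hN : 1 ≤ N) (m : ℝ) {a : ℕ → ℝ}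
    (hb : ∀ k ≤ N, 0 ≤ fluctCoeff N a k) :
    stagMode (ν := ν) (L := L) hL.two_dvd N m a ≤
      (Fintype.card (TorusSite ν L) : ℝ)⁻¹ * (1 / (4 * ν * N)) := by
  have hNpos : (0 : ℝ) < N := by exact_mod_cast hN
  have hνpos : (0 : ℝ) < ν := by exact_mod_cast hν
  have hZ0 : 0 ≤ partitionFunction (ν := ν) (L := L) N m a :=
    (partitionFunction_nonneg' hL i hcard 1 (Or.inl rfl) m hb).1
  have h1 := twoPtHat_mode_le hL i hcard hN m hb (stagChar (ν := ν) (L := L) hL.two_dvd)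
  rw [cosSum_stagChar] at h1
  rw [stagMode_eq]
  refine mul_le_mul_of_nonneg_left ?_ (by positivity)
  set Z := partitionFunction (ν := ν) (L := L) N m a
  set g := twoPtHat N m a (stagChar (ν := ν) (L := L) hL.two_dvd)
  rcases hZ0.eq_or_lt with hZ | hZ
  · rw [← hZ, div_zero]; positivity
  · rw [div_le_iff₀ hZ, div_mul_eq_mul_div, le_div_iff₀ (by positivity)]
    calc g * (4 * ν * N) = N * (2 * ((ν : ℝ) - -ν) * g) := by ring
      _ ≤ N * (1 / N * Z) := mul_le_mul_of_nonneg_left h1 hNpos.le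
      _ = 1 * Z := by field_simp

/-- `|a_Λ| ≤ 1` when `|T_Λ| ≤ 1` ((3.117)). [cite: SalmhoferSeiler1991, (3.117)] -/
theorem abs_zeroMode_le_one {N : ℕ} {m : ℝ} {a : ℕ → ℝ} (hT : ∀ x : TorusSite ν L, |corrFn N m a x| ≤ 1) :
    |zeroMode (ν := ν) (L := L) N m a| ≤ 1 := by
  have hnpos : (0 : ℝ) < Fintype.card (TorusSite ν L) := by exact_mod_cast Fintype.card_pos
  rw [zeroMode, abs_mul, abs_of_pos (inv_pos.2 hnpos), inv_mul_le_iff₀ hnpos, mul_one]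
  calc |∑ x : TorusSite ν L, corrFn N m a x| ≤ ∑ x : TorusSite ν L, |corrFn N m a x| :=
        Finset.abs_sum_le_sum_abs _ _
    _ ≤ ∑ _x : TorusSite ν L, (1 : ℝ) := Finset.sum_le_sum fun x _ => hT x
    _ = Fintype.card (TorusSite ν L) := by simp

/-- `|b_Λ| ≤ 1` when `|T_Λ| ≤ 1` ((3.117)). [cite: SalmhoferSeiler1991, (3.117)] -/
theorem abs_stagMode_le_one (hL : 2 ∣ L) {N : ℕ} {m : ℝ} {a : ℕ → ℝ}
    (hT : ∀ x : TorusSite ν L, |corrFn N m a x| ≤ 1) :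
    |stagMode (ν := ν) (L := L) hL N m a| ≤ 1 := by
  have hnpos : (0 : ℝ) < Fintype.card (TorusSite ν L) := by exact_mod_cast Fintype.card_pos
  rw [stagMode, abs_mul, abs_of_pos (inv_pos.2 hnpos), inv_mul_le_iff₀ hnpos, mul_one]
  calc |∑ x : TorusSite ν L, (sgn hL x : ℝ) * corrFn N m a x|
      ≤ ∑ x : TorusSite ν L, |(sgn hL x : ℝ) * corrFn N m a x| := Finset.abs_sum_le_sum_abs _ _
    _ ≤ ∑ _x : TorusSite ν L, (1 : ℝ) := Finset.sum_le_sum fun x _ => by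
        rw [abs_mul]
        have : |(sgn hL x : ℝ)| = 1 := by unfold sgn; split_ifs <;> simp
        rw [this, one_mul]; exact hT x
    _ = Fintype.card (TorusSite ν L) := by simp

/-! ### `m = 0`: chiral symmetry (3.101)/(3.106) ⇒ `T_Λ` vanishes on even sites and `b_Λ = -a_Λ` -/

/-- **(3.101)**: at `m = 0`, `T_Λ(x) = 0` on the even sublattice `ε(x) = 1`. [cite: SalmhoferSeiler1991, (3.101)] -/
theorem corrFn_zero_mass_eq_zero (hL : 2 ∣ L) (hν : 1 ≤ ν) (N : ℕ) (a : ℕ → ℝ)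
    {x : TorusSite ν L} (hx : parity hL x = 0) : corrFn N 0 a x = 0 := by
  rw [corrFn_eq_div, twoPt_zero_mass_eq_zero hL hν N a hx, zero_div]

/-- **(3.106) for the atoms**: at `m = 0`, `b_Λ = -a_Λ` (`c₀ = c_π̂`, used in (4.41)).
[cite: SalmhoferSeiler1991, (3.106) and (4.41)] -/
theorem stagMode_zero_mass (hL : 2 ∣ L) (hν : 1 ≤ ν) (N : ℕ) (a : ℕ → ℝ) :
    stagMode (ν := ν) (L := L) hL N 0 a = -zeroMode (ν := ν) (L := L) N 0 a := by
  rw [stagMode_eq, zeroMode_eq, twoPtHat_stagChar_zero_mass hL hν, neg_div, mul_neg]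

/-! ### Under the hypotheses of Thm. 3.18: `0 ≤ T_Λ ≤ 1`, `b_k ≥ 0` -/

/-- Thm. 3.18 (1) for the two-point function: `0 ≤ T_Λ(x) ≤ 1`. [cite: SalmhoferSeiler1991, Thm. 3.18 (1) (3.59)] -/
theorem corrFn_mem_Icc (hν : 1 ≤ ν) (hL : Even L) (hL2 : 2 ≤ L) {N : ℕ} (hN : 1 ≤ N)
    {a w : ℕ → ℝ} (hlog : HasLog N a w) (ha0 : a 0 = 1) (hw1 : w 1 = 1)
    (hw : ∀ k, 2 ≤ k → k ≤ N → 0 ≤ w k) {m : ℝ} (hm : 0 ≤ m) (x : TorusSite ν L) :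
    corrFn N m a x ∈ Set.Icc (0 : ℝ) 1 := by
  have h := expect_monomial_mem_Icc hν hL hL2 hN hlog ha0 hw1 hw hm
    (Finsupp.single (0 : TorusSite ν L) 1 + Finsupp.single x 1)
  have hm' : (X (0 : TorusSite ν L) * X x : MvPolynomial (TorusSite ν L) ℝ) =
      monomial (Finsupp.single 0 1 + Finsupp.single x 1) 1 := by
    rw [X, X, monomial_mul, mul_one]
  rw [corrFn, hm']
  exact h


/-! ### The near bound as a momentum sum -/

/-- The cut-off inverse `g_η(D) = 1/max(D, η)` (continuous in `D`, `≤ η⁻¹`), so that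
`(D⁻¹ - η⁻¹)⁺ = D⁻¹ - g_η(D)` for `D > 0`.  Plumbing. [cite: SalmhoferSeiler1991, (3.116)] -/
def cutInv (η D : ℝ) : ℝ := 1 / max D η

omit [NeZero L] in
/-- `(D⁻¹ - η⁻¹)⁺ = D⁻¹ - g_η(D)` for `D > 0`. [cite: SalmhoferSeiler1991, (3.116)] -/
theorem posPart_inv_sub_eq {η D : ℝ} (hη : 0 < η) (hD : 0 < D) :
    max (1 / D - 1 / η) 0 = 1 / D - cutInv η D := by
  unfold cutInv
  rcases le_total D η with h | h
  · rw [max_eq_right h, max_eq_left]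
    rw [sub_nonneg]; exact one_div_le_one_div_of_le hD h
  · rw [max_eq_left h, sub_self, max_eq_right]
    rw [sub_nonpos]; exact one_div_le_one_div_of_le hη h

omit [NeZero L] in
/-- `D⁻¹ - g_η(D) ≤ (D⁻¹ - η⁻¹)⁺` for every real `D` (with `0⁻¹ = 0`). [cite: SalmhoferSeiler1991, (3.116)] -/
theorem inv_sub_cutInv_le (η D : ℝ) :
    1 / D - cutInv η D ≤ max (1 / D - 1 / η) 0 := by
  unfold cutInv
  rcases le_total D η with h | h
  · rw [max_eq_right h]; exact le_max_left _ _
  · rw [max_eq_left h, sub_self]; exact le_max_right _ _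

omit [NeZero L] in
/-- `0 ≤ g_η(D) ≤ η⁻¹`. [cite: SalmhoferSeiler1991, (3.116)] -/
theorem cutInv_le {η : ℝ} (hη : 0 < η) (D : ℝ) : cutInv η D ≤ 1 / η :=
  one_div_le_one_div_of_le hη (le_max_right _ _)

/-- **The near bound is a momentum sum**:
`n_Λ(η) = N⁻¹ (R_Λ(ν) - L^{-ν} ∑_k g_η(D(p_k)) + L^{-ν} η⁻¹)` with the torus Green function
`R_Λ(ν) = torusGreen 0 = L^{-ν} ∑_{k ≠ 0} D(p_k)⁻¹` (the singular part, (A.4)) and the Riemann sum of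
the continuous function `g_η ∘ D`. [cite: SalmhoferSeiler1991, (3.116)–(3.118) with Appendix (A.4)] -/
theorem nearBound_eq (hL2 : 2 ≤ L) {η : ℝ} (hη : 0 < η) (N : ℕ) :
    nearBound ν L η N = 1 / N * (torusGreen (0 : TorusSite ν L)
      - ((L : ℝ) ^ ν)⁻¹ * ∑ k : TorusSite ν L, cutInv η (dispersion (latticeMomentum L k))
      + ((L : ℝ) ^ ν)⁻¹ * (1 / η)) := by
  classical
  unfold nearBound
  congr 1
  have hcard : (Fintype.card (TorusSite ν L) : ℝ) = (L : ℝ) ^ ν := by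
    rw [card_torusSite]; push_cast; rfl
  rw [hcard]
  -- termwise identity
  have hterm : ∀ χ : AddChar (TorusSite ν L) ℂ, max (1 / ((ν : ℝ) - cosSum χ) - 1 / η) 0 =
      (if χ = 0 then 0 else 1 / ((ν : ℝ) - cosSum χ)) - cutInv η ((ν : ℝ) - cosSum χ)
        + (if χ = 0 then 1 / η else 0) := by
    intro χ
    by_cases h0 : χ = 0
    · subst h0
      rw [if_pos rfl, if_pos rfl, cosSum_zero, sub_self, div_zero, zero_sub, cutInv,
        max_eq_right hη.le, max_eq_right (neg_nonpos.2 (one_div_nonneg.2 hη.le))]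
      ring
    · rw [if_neg h0, if_neg h0, add_zero]
      exact posPart_inv_sub_eq hη (sub_pos.2 (cosSum_lt_of_ne_zero h0))
  simp_rw [hterm]
  rw [Finset.sum_add_distrib, Finset.sum_sub_distrib, sum_inv_dispersion_eq_torusGreen hL2,
    Finset.sum_ite_eq' Finset.univ (0 : AddChar (TorusSite ν L) ℂ), if_pos (Finset.mem_univ _)]
  have hg : ∑ χ : AddChar (TorusSite ν L) ℂ, cutInv η ((ν : ℝ) - cosSum χ) =
      ∑ k : TorusSite ν L, cutInv η (dispersion (latticeMomentum L k)) := by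
    rw [← momentumChar_bijective.sum_comp (fun χ => cutInv η ((ν : ℝ) - cosSum χ))]
    simp only [cosSum_momentumChar hL2, sub_sub_cancel]
  rw [hg]
  have hL0 : (L : ℝ) ^ ν ≠ 0 := pow_ne_zero ν (by exact_mod_cast NeZero.ne L)
  field_simp

end Torus

/-! ### The thermodynamic limit of the near bound, and its vanishing as `η → 0` -/

/-- The limit of the near bounds: `n(η) = N⁻¹ (R(ν) - (2π)^{-ν} ∫_{[-π,π]^ν} g_η(D(p)) dp)`,
`R(ν) = latticeGreen 0`. [cite: SalmhoferSeiler1991, (3.119) with Appendix (A.4)] -/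
def nearLimit (ν : ℕ) (η : ℝ) (N : ℕ) : ℝ :=
  1 / N * (latticeGreen (0 : Site ν)
    - (∫ p in brillouin ν, cutInv η (dispersion p)) / ((2 * Real.pi) ^ ν))

/-- `D` is `2π`-periodic in each coordinate. [folklore] -/
private theorem dispersion_add_int_mul (p : Fin ν → ℝ) (n : Fin ν → ℤ) :
    dispersion (fun i => p i + 2 * Real.pi * (n i : ℝ)) = dispersion p := by
  unfold dispersion
  refine Finset.sum_congr rfl fun i _ => ?_
  show 1 - Real.cos (p i + 2 * Real.pi * (n i : ℝ)) = 1 - Real.cos (p i)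
  rw [show p i + 2 * Real.pi * (n i : ℝ) = p i + (n i : ℝ) * (2 * Real.pi) by ring,
    Real.cos_add_int_mul_two_pi]

/-- `g_η ∘ D` is continuous (`max(D, η) ≥ η > 0`). [folklore] -/
private theorem continuous_cutInv_dispersion {η : ℝ} (hη : 0 < η) :
    Continuous fun p : Fin ν → ℝ => cutInv η (dispersion p) := by
  unfold cutInv
  refine continuous_const.div ((continuous_dispersion ν).max continuous_const) fun p => ?_
  exact (lt_of_lt_of_le hη (le_max_right _ _)).ne'

/-- `Torus.proj L 0 = 0`. [folklore] -/
private theorem torus_proj_zero' (L : ℕ) : Torus.proj L (0 : Site ν) = 0 := by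
  funext i; simp [Torus.proj]

/-- Riemann sums of the continuous part `g_η ∘ D`. [cite: FriedliVelenik2017, §10.5.2 (10.41)] -/
theorem momentumAverage_cutInv_approx {η : ℝ} (hη : 0 < η) {ε : ℝ} (hε : 0 < ε) :
    ∃ L₀ : ℕ, ∀ (L : ℕ) [NeZero L], Even L → L₀ ≤ L →
      |((L : ℝ) ^ ν)⁻¹ * ∑ k : TorusSite ν L, cutInv η (dispersion (latticeMomentum L k))
        - (∫ p in brillouin ν, cutInv η (dispersion p)) / ((2 * Real.pi) ^ ν)| ≤ ε := by
  have hcont := continuous_cutInv_dispersion (ν := ν) hη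
  obtain ⟨L₀, hL₀⟩ := momentumAverage_uniform_approx (d := ν) (Y := Unit) (E := ℝ)
    (C := Set.univ) isCompact_univ (G := fun p _ => cutInv η (dispersion p))
    ((hcont.comp continuous_fst).continuousOn)
    (fun p _ n => by simp only [dispersion_add_int_mul]) hε
  refine ⟨L₀, fun L _ hLe hL => ?_⟩
  have h := hL₀ L hL hLe () (Set.mem_univ _)
  rw [Real.norm_eq_abs] at h
  simp only [smul_eq_mul] at h
  push_cast at h
  rwa [div_eq_inv_mul]

/-- **The near bounds converge**: for `ν ≥ 3`, `η > 0`, `δ > 0` and all large even `L`,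
`|n_Λ(η) - n(η)| ≤ δ` ("because `b` is integrable, the sum converges to `(2π)^{-ν}‖b‖₁`",
(3.118)–(3.119), here for the part of `b` above height `η⁻¹`: `R_Λ → R`
(`torusGreen_tendsto_latticeGreen`) and Riemann sums of `g_η ∘ D`).
[cite: SalmhoferSeiler1991, (3.118)–(3.119)] -/
theorem nearBound_tendsto (hν : 3 ≤ ν) {η : ℝ} (hη : 0 < η) {N : ℕ} (hN : 1 ≤ N) {δ : ℝ}
    (hδ : 0 < δ) :
    ∃ L₀ : ℕ, ∀ (L : ℕ) [NeZero L], Even L → L₀ ≤ L →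
      |nearBound ν L η N - nearLimit ν η N| ≤ δ := by
  have hν1 : 1 ≤ ν := by omega
  have hNpos : (0 : ℝ) < N := by exact_mod_cast hN
  have hN1 : (1 : ℝ) ≤ N := by exact_mod_cast hN
  obtain ⟨L₁, hL₁⟩ := torusGreen_tendsto_latticeGreen (d := ν) hν (0 : Site ν)
    (ε := δ / 3) (by positivity)
  obtain ⟨L₂, hL₂⟩ := momentumAverage_cutInv_approx (ν := ν) hη (ε := δ / 3) (by positivity)
  obtain ⟨L₃, hL₃⟩ := exists_nat_gt (3 / (δ * η))
  refine ⟨max (max L₁ L₂) (max L₃ 2), fun L _ hL hLe => ?_⟩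
  have hL1 : L₁ ≤ L := le_trans (le_max_left _ _) (le_trans (le_max_left _ _) hLe)
  have hL2 : L₂ ≤ L := le_trans (le_max_right _ _) (le_trans (le_max_left _ _) hLe)
  have hL3 : L₃ ≤ L := le_trans (le_max_left _ _) (le_trans (le_max_right _ _) hLe)
  have hL4 : 2 ≤ L := le_trans (le_max_right _ _) (le_trans (le_max_right _ _) hLe)
  have hG := hL₁ L hL hL1
  rw [torus_proj_zero'] at hG
  have hH := hL₂ L hL hL2
  have hLpos : (0 : ℝ) < L := by exact_mod_cast (show 0 < L by omega)
  -- the zero-mode correction `L^{-ν} η⁻¹ ≤ δ/3`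
  have hinv : ((L : ℝ) ^ ν)⁻¹ * (1 / η) ≤ δ / 3 := by
    have h1 : (L : ℝ) ≤ (L : ℝ) ^ ν := by
      calc (L : ℝ) = (L : ℝ) ^ 1 := (pow_one _).symm
        _ ≤ (L : ℝ) ^ ν := pow_le_pow_right₀ (by exact_mod_cast (show 1 ≤ L by omega)) hν1
    have h2 : (3 : ℝ) / (δ * η) < L := lt_of_lt_of_le hL₃ (by exact_mod_cast hL3)
    have h3 : ((L : ℝ) ^ ν)⁻¹ ≤ (L : ℝ)⁻¹ := inv_anti₀ hLpos h1
    have h4 : (L : ℝ)⁻¹ * (1 / η) ≤ δ / 3 := by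
      rw [inv_mul_le_iff₀ hLpos]
      have : (1 : ℝ) / η * 3 ≤ L * δ := by
        calc (1 : ℝ) / η * 3 = 3 / (δ * η) * δ := by field_simp
          _ ≤ L * δ := mul_le_mul_of_nonneg_right h2.le hδ.le
      linarith
    exact (mul_le_mul_of_nonneg_right h3 (by positivity)).trans h4
  rw [nearBound_eq hL4 hη, nearLimit, ← mul_sub, abs_mul, abs_of_pos (by positivity : (0:ℝ) < 1 / N)]
  have hI0 : 0 ≤ ((L : ℝ) ^ ν)⁻¹ * (1 / η) := by positivity
  calc 1 / (N : ℝ) * |torusGreen (0 : TorusSite ν L)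
        - ((L : ℝ) ^ ν)⁻¹ * ∑ k : TorusSite ν L, cutInv η (dispersion (latticeMomentum L k))
        + ((L : ℝ) ^ ν)⁻¹ * (1 / η)
        - (latticeGreen (0 : Site ν) - (∫ p in brillouin ν, cutInv η (dispersion p)) / (2 * Real.pi) ^ ν)|
      ≤ 1 * |torusGreen (0 : TorusSite ν L)
        - ((L : ℝ) ^ ν)⁻¹ * ∑ k : TorusSite ν L, cutInv η (dispersion (latticeMomentum L k))
        + ((L : ℝ) ^ ν)⁻¹ * (1 / η)
        - (latticeGreen (0 : Site ν) - (∫ p in brillouin ν, cutInv η (dispersion p)) / (2 * Real.pi) ^ ν)| :=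
        mul_le_mul_of_nonneg_right (by rw [div_le_one hNpos]; exact hN1) (abs_nonneg _)
    _ = |(torusGreen (0 : TorusSite ν L) - latticeGreen (0 : Site ν))
        + -(((L : ℝ) ^ ν)⁻¹ * ∑ k : TorusSite ν L, cutInv η (dispersion (latticeMomentum L k))
            - (∫ p in brillouin ν, cutInv η (dispersion p)) / (2 * Real.pi) ^ ν)
        + ((L : ℝ) ^ ν)⁻¹ * (1 / η)| := by ring_nf
    _ ≤ |(torusGreen (0 : TorusSite ν L) - latticeGreen (0 : Site ν))
        + -(((L : ℝ) ^ ν)⁻¹ * ∑ k : TorusSite ν L, cutInv η (dispersion (latticeMomentum L k))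
            - (∫ p in brillouin ν, cutInv η (dispersion p)) / (2 * Real.pi) ^ ν)|
        + |((L : ℝ) ^ ν)⁻¹ * (1 / η)| := abs_add_le _ _
    _ ≤ (|torusGreen (0 : TorusSite ν L) - latticeGreen (0 : Site ν)|
        + |-(((L : ℝ) ^ ν)⁻¹ * ∑ k : TorusSite ν L, cutInv η (dispersion (latticeMomentum L k))
            - (∫ p in brillouin ν, cutInv η (dispersion p)) / (2 * Real.pi) ^ ν)|)
        + |((L : ℝ) ^ ν)⁻¹ * (1 / η)| := by gcongr; exact abs_add_le _ _
    _ ≤ (δ / 3 + δ / 3) + δ / 3 := by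
        gcongr
        · rwa [abs_neg]
        · rwa [abs_of_nonneg hI0]
    _ = δ := by ring

/-- `(2π)^{-ν} ∫ D⁻¹` at `z = 0` is the lattice Green function `R(ν)`. [cite: SalmhoferSeiler1991, Appendix (A.4)] -/
private theorem latticeGreen_zero_eq :
    latticeGreen (0 : Site ν) = (∫ p in brillouin ν, 1 / dispersion p) / ((2 * Real.pi) ^ ν) := by
  unfold latticeGreen
  simp only [Pi.zero_apply, Int.cast_zero, mul_zero, Finset.sum_const_zero, Real.cos_zero]

/-- `D⁻¹` is integrable on the Brillouin zone for `ν ≥ 3`. [cite: SalmhoferSeiler1991, Prop. 4.2 (1)] -/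
private theorem integrableOn_inv_dispersion (hν : 3 ≤ ν) :
    IntegrableOn (fun p : Fin ν → ℝ => 1 / dispersion p) (brillouin ν) := by
  rw [← integrable_indicator_iff (measurableSet_brillouin ν)]
  exact integrable_indicator_inv_dispersion ν hν

/-- `(D⁻¹ - η⁻¹)⁺` is integrable on the Brillouin zone (dominated by `D⁻¹`). [cite: SalmhoferSeiler1991, (3.114) (b ∈ L¹)] -/
private theorem integrableOn_posPart (hν : 3 ≤ ν) (c : ℝ) (hc : 0 ≤ c) :
    IntegrableOn (fun p : Fin ν → ℝ => max (1 / dispersion p - c) 0) (brillouin ν) := by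
  refine Integrable.mono' (integrableOn_inv_dispersion hν) ?_ ?_
  · exact ((((continuous_dispersion ν).measurable).const_div 1).sub_const c |>.max
      measurable_const).aestronglyMeasurable
  · refine Filter.Eventually.of_forall fun p => ?_
    have h0 : 0 ≤ 1 / dispersion p := div_nonneg zero_le_one (dispersion_nonneg p)
    rw [Real.norm_eq_abs, abs_of_nonneg (le_max_right _ _)]
    exact max_le (by linarith) h0

/-- **`n(η) ≤ N⁻¹ (2π)^{-ν} ∫ (D⁻¹ - η⁻¹)⁺`**: the limit of the near bounds is at most the
`L¹`-mass of `b` above height `η⁻¹`. [cite: SalmhoferSeiler1991, (3.119)] -/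
theorem nearLimit_le (hν : 3 ≤ ν) {η : ℝ} (hη : 0 < η) {N : ℕ} (hN : 1 ≤ N) :
    nearLimit ν η N ≤
      1 / N * ((∫ p in brillouin ν, max (1 / dispersion p - 1 / η) 0) / ((2 * Real.pi) ^ ν)) := by
  have hNpos : (0 : ℝ) < N := by exact_mod_cast hN
  have h2π : (0 : ℝ) < (2 * Real.pi) ^ ν := by positivity
  have hI1 := integrableOn_inv_dispersion hν
  have hI2 : IntegrableOn (fun p : Fin ν → ℝ => cutInv η (dispersion p)) (brillouin ν) :=
    (continuous_cutInv_dispersion hη).continuousOn.integrableOn_compact (isCompact_brillouin ν)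
  have hI3 := integrableOn_posPart hν (1 / η) (by positivity)
  unfold nearLimit
  rw [latticeGreen_zero_eq, ← sub_div, ← integral_sub hI1 hI2]
  refine mul_le_mul_of_nonneg_left ?_ (by positivity)
  rw [div_le_div_iff_of_pos_right h2π]
  exact setIntegral_mono (hI1.sub hI2) hI3 fun p => inv_sub_cutInv_le η (dispersion p)

/-- **The `L¹`-mass of `b` above height `η⁻¹` vanishes as `η → 0`** (`b ∈ L¹(ℬ_ν)` for `ν ≥ 3`;
dominated convergence along `η = 1/(n+1)`). [cite: SalmhoferSeiler1991, (3.114) and (3.119)] -/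
theorem tendsto_integral_posPart_inv_dispersion (hν : 3 ≤ ν) :
    Tendsto (fun n : ℕ => ∫ p in brillouin ν, max (1 / dispersion p - ((n : ℝ) + 1)) 0)
      atTop (nhds 0) := by
  have hI1 := integrableOn_inv_dispersion hν
  have h := tendsto_integral_of_dominated_convergence (μ := volume.restrict (brillouin ν))
    (F := fun (n : ℕ) (p : Fin ν → ℝ) => max (1 / dispersion p - ((n : ℝ) + 1)) 0)
    (f := fun _ => (0 : ℝ)) (fun p => 1 / dispersion p) ?_ hI1 ?_ ?_
  · simpa using h
  · intro n
    exact ((((continuous_dispersion ν).measurable).const_div 1).sub_const _ |>.max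
      measurable_const).aestronglyMeasurable
  · intro n
    refine Filter.Eventually.of_forall fun p => ?_
    have h0 : 0 ≤ 1 / dispersion p := div_nonneg zero_le_one (dispersion_nonneg p)
    have hn0 : (0 : ℝ) ≤ (n : ℝ) + 1 := by positivity
    rw [Real.norm_eq_abs, abs_of_nonneg (le_max_right _ _)]
    exact max_le (by linarith) h0
  · refine Filter.Eventually.of_forall fun p => ?_
    obtain ⟨n₀, hn₀⟩ := exists_nat_ge (1 / dispersion p)
    refine (tendsto_const_nhds (x := (0 : ℝ))).congr' ?_
    filter_upwards [Filter.eventually_ge_atTop n₀] with n hn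
    have : (n₀ : ℝ) ≤ n := by exact_mod_cast hn
    rw [max_eq_right (by linarith)]

/-- **`n(η) → 0`**: for `ν ≥ 3` and every `δ > 0` there is `η > 0` with `n(η) ≤ δ`.
[cite: SalmhoferSeiler1991, (3.119)] -/
theorem exists_nearLimit_le (hν : 3 ≤ ν) {N : ℕ} (hN : 1 ≤ N) {δ : ℝ} (hδ : 0 < δ) :
    ∃ η : ℝ, 0 < η ∧ nearLimit ν η N ≤ δ := by
  have h2π : (1 : ℝ) ≤ (2 * Real.pi) ^ ν := by
    refine one_le_pow₀ ?_
    have := Real.pi_gt_three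
    linarith
  have hNpos : (0 : ℝ) < N := by exact_mod_cast hN
  have hN1 : 1 / (N : ℝ) ≤ 1 := by rw [div_le_one hNpos]; exact_mod_cast hN
  have h := tendsto_integral_posPart_inv_dispersion hν
  obtain ⟨n, hn⟩ := (h.eventually (gt_mem_nhds hδ)).exists
  set I : ℝ := ∫ p in brillouin ν, max (1 / dispersion p - ((n : ℝ) + 1)) 0 with hI
  have hI0 : 0 ≤ I := setIntegral_nonneg (measurableSet_brillouin ν) fun p _ => le_max_right _ _
  refine ⟨1 / ((n : ℝ) + 1), by positivity, ?_⟩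
  calc nearLimit ν (1 / ((n : ℝ) + 1)) N
      ≤ 1 / N * ((∫ p in brillouin ν, max (1 / dispersion p - 1 / (1 / ((n : ℝ) + 1))) 0) /
          ((2 * Real.pi) ^ ν)) := nearLimit_le hν (by positivity) hN
    _ = 1 / N * (I / ((2 * Real.pi) ^ ν)) := by rw [one_div_one_div]
    _ ≤ 1 * I := by
        refine mul_le_mul hN1 (div_le_self hI0 h2π) (by positivity) zero_le_one
    _ ≤ δ := by rw [one_mul]; exact hn.le

/-! ### The staggered sign on `ℤ^ν` and its reading on the even tori -/

/-- The staggered sign `ε(x) = (-1)^{∑_μ x_μ}` on `ℤ^ν` ((2.8): `ε(x) = e^{iπ̂x}`), as a real number.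
[cite: SalmhoferSeiler1991, (2.8)] -/
def latSgn (x : Site ν) : ℝ := if Even (∑ i, x i) then 1 else -1

/-- `ε(x)² = 1`, i.e. `ε(x) ∈ {1, -1}`. [cite: SalmhoferSeiler1991, (2.8)] -/
theorem latSgn_eq_one_or (x : Site ν) : latSgn x = 1 ∨ latSgn x = -1 := by
  unfold latSgn; split_ifs <;> simp

/-- The parity of a site of `ℤ^ν` read on an even torus. [cite: SalmhoferSeiler1991, (2.8)] -/
theorem parity_proj_eq_zero_iff {L : ℕ} (hL : 2 ∣ L) (x : Site ν) :
    parity hL (Torus.proj L x) = 0 ↔ Even (∑ i, x i) := by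
  unfold parity Torus.proj
  have h : ∀ j, ZMod.castHom hL (ZMod 2) ((x j : ℤ) : ZMod L) = ((x j : ℤ) : ZMod 2) :=
    fun j => map_intCast _ _
  simp_rw [h]
  rw [← Int.cast_sum, ZMod.intCast_zmod_eq_zero_iff_dvd, even_iff_two_dvd]
  norm_cast

/-- `ε(x mod L) = ε(x)` for even `L`. [cite: SalmhoferSeiler1991, (2.8)] -/
theorem sgn_proj {L : ℕ} (hL : 2 ∣ L) (x : Site ν) :
    (sgn hL (Torus.proj L x) : ℝ) = latSgn x := by
  unfold sgn latSgn
  by_cases h : Even (∑ i, x i)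
  · rw [if_pos ((parity_proj_eq_zero_iff hL x).2 h), if_pos h]; simp
  · rw [if_neg (fun h' => h ((parity_proj_eq_zero_iff hL x).1 h')), if_neg h]; simp

end ComplexSpin

end Literature.MathematicalPhysics.StatisticalMechanics

end
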